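import Summits.Ventures.CertifiedManyBodySolver.Transport.ChainWindowBlocks
import Summits.Ventures.CertifiedManyBodySolver.Transport.LTIPrimalHubbardBridge
import HarnessLib

/-!
# Ventures/CertifiedManyBodySolver — Transport/LTIPrimalHubbardChainEnt.lean

Speedrun cell sr-mbsolver — LIT team (lit-1 gen-6), D-19 r104/r108/r113 (ENT-B0 transport, part 3 of 3): lane-B transport, PRIMAL form, `lti(n)` rows WITH THE
ENTROPY (weak-monotonicity) CONSTRAINT of Fawzi–Fawzi–Scalet, fermion statistics (the Hubbard chain) — "ENT-B0".
HONEST FRAMING: first certified bounds; not a superconductivity verdict; every number certified or labelled float.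

WHAT THIS GIVES. An `ent` certificate (op-08 `entropy-cuts.md` §1/§4) proves `E ≤ Re tr(h ρ)` for every window variable
`ρ : Op (PolySite W') 4`, `W' = {-1, 0, …, n+1}`, satisfying the rows of the by-value node of `Transport/LTIPrimalHubbardChain.lean`
(THEOREM B0: `ρ ⪰ 0`, `tr ρ = 1`, local translation invariance, `N_↑/N_↓` sector zeros, density, real entries bounded by one)
AND the entropy row `0 ≤ S(ρ) − S(tr_{last site} ρ)` (`S = vonNeumannEntropy`; every valid tangent cut of the certificate is implied
by it, `Entropy/EntropyCutValidity.lean`). `ent_primal_chainWindow_energyPerSite_ge` transports such a node BY VALUE to every ring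
`L` on which `x ↦ x mod L` is injective on the doubled window `{-1, …, 2n+3}` (`E ≤ E₀(ring L, 2nh)/L` at density `nh/L`);
`ent_primal_chainWindow_energyDensity_ge` (`ν = 1/2`) and `ent_primal_chainWindow_energyDensityAt_ge` (`ν = p/(2q)`) pass to the
thermodynamic limit. Also here (for the `tl_marginal`-shaped node of `Transport/LTIPrimalHubbardChainEntTLM.lean`): translates of an even
observable of the two-site sub-window `{-1, 0}` have equal expectations under the LTI row (`trace_toSpin_translate_eq_of_lti`).

PROOF (Fawzi–Fawzi–Scalet 2024, Thm 4.1, first inclusion `LocTI(2l−1) ⊂ WMTI(l)`, read on the Jordan–Wigner chain). Take the honest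
feasible point `σ` of THEOREM B0 on the DOUBLED window `W = {-1, …, 2n+3}` (`exists_lti_feasible_chain`: a real density matrix with
ONE local-translation-invariance row and the ring's energy). (1) Shift consistency (`spinPartialTrace_eq_of_shift`, `Transport/ChainWindowShift.lean`): by
functoriality of the partial trace that one row makes EVERY translated copy of every sub-window carry the same marginal.
(2) Restriction (`spinPartialTrace (incl) σ`) to the lower sub-window `W'` inherits all rows of the node and the objective
(`W'` is an initial segment, so no Jordan–Wigner string enters: `toSpin_fermionEmbed_of_strictMono_of_isLowerSet`). (3) `W` splits into
the three blocks (`Transport/ChainWindowBlocks.lean`) `{-1,…,n} ⊔ {n+1} ⊔ {n+2,…,2n+3}`; the marginals on `{-1,…,n+1}` / `{n+1,…,2n+3}` and on `{-1,…,n}` / `{n+2,…,2n+3}`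
coincide by (1), so weak monotonicity of the von Neumann entropy (tree THEOREM `weak_monotonicity_holds`, through lit-4's site-indexed
form `entropy_increment_nonneg_of_shift_invariant'`) gives `0 ≤ S(ρ_{W'}) − S(ρ_{\{-1,…,n\}})`.
[cite: FawziFawziScalet2024Entropy, Theorem 4.1 (proof) and Lemma 2.1] [cite: KullEtAl2024, §II.B, §VI.B] [cite: Han2020Bootstrap, §2]

NOT COVERED: the `G`-identification rows (spin flip, reflection, particle–hole) of op-08's formulation-B problem files — a node carrying
them needs, in addition, the `G`-invariance of the feasible point written in the Jordan–Wigner product basis (follow-up).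
-/

noncomputable section

open Matrix Complex Filter Topology
open scoped ComplexOrder
open Literature.Probability.LatticeModels
open Literature.MathematicalPhysics.QuantumLattice
open Literature.MathematicalPhysics.QuantumLattice.HubbardWave0
open Literature.MathematicalPhysics.QuantumLattice.ThermodynamicLimit
open Literature.MathematicalPhysics.QuantumLattice.JordanWigner
open Literature.MathematicalPhysics.QuantumManyBody.StateRelaxation
open Literature.InformationTheory.Entropy (vonNeumannEntropy)

namespace Summit.Ventures.CertifiedManyBodySolver.Transport

/-! ### The honest feasible point WITH the entropy row, and the transport to every ring -/

section Ring

variable {L : ℕ} [NeZero L]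

/-- The unit vector of the chain has coordinate `1`. [folklore] -/
theorem chain_unitVec_apply_zero : (unitVec (0 : Fin 1) : Site 1) 0 = 1 := by
  simp [unitVec]

/-- **The honest feasible point of the ENT node (non-vacuity, with the ring's energy).** For the canonical window
`W' = {-1, 0, …, n+1}`, its left sub-window `{-1, …, n}` and the unit translation, on every ring `L ≥ 3` on which `x ↦ x mod L`
is injective on the doubled window `{-1, …, 2n+3}`, some window variable `ρ : Op (PolySite W') 4` satisfies every row of the
by-value node of THEOREM B0 with density `nh/L`, the ENTROPY ROW `0 ≤ S(ρ) − S(tr_{n+1} ρ)`, and has objective value exactly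
`E₀(ring L, 2nh)/L`. Construction in the module docstring (restriction of the B0 point of the doubled window; Fawzi–Fawzi–Scalet
Thm 4.1 first step through `weak_monotonicity_holds`). [cite: FawziFawziScalet2024Entropy, Theorem 4.1 (proof), Lemma 2.1]
[cite: KullEtAl2024, §II.B, §VI.B] -/
theorem exists_lti_ent_feasible_chainWindow (t U : ℝ) (n : ℕ) (hL : 3 ≤ L) {nh : ℕ} (hn : nh ≤ L)
    (hInj : Set.InjOn (Torus.proj (d := 1) L) ↑(chainWindow (-1) (2 * (n : ℤ) + 3))) :
    ∃ ρ : Op (PolySite (chainWindow (-1) ((n : ℤ) + 1))) 4, ρ.PosSemidef ∧ ρ.trace = 1 ∧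
      spinPartialTrace ((PolySite.affEmb 1 (unitVec 0) (chainWindow (-1) (n : ℤ))).trans
          (PolySite.incl (affShiftSet_chainWindow_subset (-1) (n : ℤ)))) ρ =
        spinPartialTrace (PolySite.incl (chainWindow_mono_right (-1) (by omega : (n : ℤ) ≤ n + 1))) ρ ∧
      (∀ σ : Fin 2, ∀ k k' : TensorIndex (PolySite (chainWindow (-1) ((n : ℤ) + 1))) 4,
        (∑ x, if σ ∈ siteOcc (k x) then 1 else 0 : ℕ) ≠ (∑ x, if σ ∈ siteOcc (k' x) then 1 else 0 : ℕ) → ρ k k' = 0) ∧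
      (∀ σ : Fin 2, ((toSpin (nAt 0 (zero_mem_chainWindow (by omega : (0 : ℤ) ≤ n + 1)) σ) * ρ).trace).re =
        (nh : ℝ) / (L : ℝ)) ∧
      (∀ k k' : TensorIndex (PolySite (chainWindow (-1) ((n : ℤ) + 1))) 4, starRingEnd ℂ (ρ k k') = ρ k k') ∧
      (∀ k k' : TensorIndex (PolySite (chainWindow (-1) ((n : ℤ) + 1))) 4, ‖ρ k k'‖ ≤ 1) ∧
      0 ≤ vonNeumannEntropy ρ -
        vonNeumannEntropy (spinPartialTrace (PolySite.incl (chainWindow_mono_right (-1) (by omega : (n : ℤ) ≤ n + 1))) ρ) ∧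
      ((toSpin (fermionEmbed (PolySite.incl (thicken_zero_one_subset_chainWindow (by omega : (1 : ℤ) ≤ n + 1)))
        ((hubbardFermionInteraction 1 t U).meanEnergyObs 1)) * ρ).trace).re = energyPerSite (hubbardChain L) t U (2 * nh) := by
  -- the doubled window `W = {-1, …, 2n+3}` = `chainWindow (-1) (2n+2+1)` and its sub-window `W₀ = {-1, …, 2n+2}`
  have hW : (2 * (n : ℤ) + 3) = 2 * (n : ℤ) + 2 + 1 := by ring
  rw [hW] at hInj
  have hW₀W : chainWindow (-1) (2 * (n : ℤ) + 2) ⊆ chainWindow (-1) (2 * (n : ℤ) + 2 + 1) :=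
    chainWindow_mono_right (-1) (by omega)
  obtain ⟨σ, hσpsd, hσtr, hσLTI, hσsec, hσdens, hσreal, -, hσobj⟩ :=
    exists_lti_feasible_chain (L := L) t U hL hn hW₀W (unitVec 0) (affShiftSet_chainWindow_subset (-1) (2 * (n : ℤ) + 2))
      (thicken_zero_one_subset_chainWindow (by omega : (1 : ℤ) ≤ 2 * (n : ℤ) + 2 + 1))
      (zero_mem_chainWindow (by omega : (0 : ℤ) ≤ 2 * (n : ℤ) + 2 + 1)) hInj
      (isLowerSet_range_incl_chainWindow _) (strictMono_affEmb_trans_incl _)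
      (ordConnected_range_affEmb_trans_incl (2 * (n : ℤ) + 2) _)
  -- the two LTI embeddings of `W₀` are the translations by `0` and `1`
  have hφ₀ := shift_incl hW₀W
  have hφ₁ : ∀ y, ofLex (((PolySite.affEmb 1 (unitVec 0) (chainWindow (-1) (2 * (n : ℤ) + 2))).trans
      (PolySite.incl (affShiftSet_chainWindow_subset (-1) (2 * (n : ℤ) + 2)))) y).1 0 = ofLex y.1 0 + 1 := fun y => by
    rw [shift_affEmb_trans_incl, chain_unitVec_apply_zero]
  set ρ : Op (PolySite (chainWindow (-1) ((n : ℤ) + 1))) 4 := spinPartialTrace (PolySite.incl (entW_sub_mid n)) σ with hρdef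
  have hρpsd : ρ.PosSemidef := posSemidef_spinPartialTrace _ hσpsd
  have hρtr : ρ.trace = 1 := by rw [hρdef, trace_spinPartialTrace, hσtr]
  -- shift consistency on `W`: the translated copies of the sub-windows carry the same marginals
  have hSB : spinPartialTrace (shiftByEmb _ _ ((n : ℤ) + 2) (entW_shift_mem_SB n)) σ =
      spinPartialTrace (PolySite.incl (entW_sub_mid n)) σ :=
    spinPartialTrace_eq_of_shift hφ₀ hφ₁ hσLTI (n + 2)
      (fun y => by
        change ofLex y.1 0 + ((n : ℤ) + 2) = _
        push_cast
        ring)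
      (shift_incl (entW_sub_mid n))
  have hB : spinPartialTrace (shiftByEmb _ _ ((n : ℤ) + 3) (entW_shift_mem_B n)) σ =
      spinPartialTrace (PolySite.incl (entW_sub_left_big n)) σ :=
    spinPartialTrace_eq_of_shift hφ₀ hφ₁ hσLTI (n + 3)
      (fun y => by
        change ofLex y.1 0 + ((n : ℤ) + 3) = _
        push_cast
        ring)
      (shift_incl (entW_sub_left_big n))
  refine ⟨ρ, hρpsd, hρtr, ?_, ?_, ?_, ?_, norm_apply_le_one_of_posSemidef hρpsd hρtr, ?_, ?_⟩
  · -- local translation invariance on the sub-window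
    rw [hρdef, ← spinPartialTrace_trans, ← spinPartialTrace_trans]
    refine spinPartialTrace_eq_of_shift hφ₀ hφ₁ hσLTI 1 ?_ ?_
    · intro y
      rw [shift_trans (shift_affEmb_trans_incl (unitVec (0 : Fin 1)) (affShiftSet_chainWindow_subset (-1) (n : ℤ)))
        (shift_incl (entW_sub_mid n)), chain_unitVec_apply_zero]
      push_cast
      ring
    · intro y
      rw [shift_trans (shift_incl (entW_sub_left n)) (shift_incl (entW_sub_mid n)), add_zero]
  · intro s k k' hne
    exact spinPartialTrace_apply_eq_zero_of_sector _ s (hσsec s) hne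
  · intro s
    rw [hρdef, trace_toSpin_mul_spinPartialTrace_incl (entW_sub_mid n) (isLowerSet_range_incl_chainWindow _),
      fermionEmbed_incl_nAt]
    exact hσdens s
  · intro k k'
    exact conj_spinPartialTrace_apply _ hσreal k k'
  · -- the entropy row: weak monotonicity on the three blocks of `W` (Fawzi–Fawzi–Scalet Thm 4.1, first step)
    have hY := entropy_increment_nonneg_of_shift_invariant' (blockEquivY n) (blockEquivAS n) (blockEquivSB n)
      (blockEquivY_hA n) (blockEquivY_hAS n) (blockEquivY_hSB n) (blockEquivY_hB n) σ hσpsd hσtr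
      (congrArg vonNeumannEntropy hSB) (congrArg vonNeumannEntropy hB)
    have e : spinPartialTrace (PolySite.incl (entW_sub_left_big n)) σ = spinPartialTrace (PolySite.incl (entW_sub_left n)) ρ := by
      rw [hρdef, ← spinPartialTrace_trans, PolySite.incl_trans]
    rw [e] at hY
    exact hY
  · rw [hρdef, trace_toSpin_mul_spinPartialTrace_incl (entW_sub_mid n) (isLowerSet_range_incl_chainWindow _),
      fermionEmbed_fermionEmbed, PolySite.incl_trans]
    exact hσobj

/-- **THEOREM ENT-B0, fermion case (ring form), canonical window.** For the window `W' = {-1, 0, …, n+1}`, its left sub-window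
`{-1, …, n}`, the unit translation and density target `ν = nh/L`: if `E ≤ Re tr(h ρ)` for every window variable
`ρ : Op (PolySite W') 4` satisfying the rows of the by-value node of THEOREM B0 AND the entropy row
`0 ≤ S(ρ) − S(tr_{n+1} ρ)`, then `E ≤ E₀(ring L, N = 2nh)/L` for every `L ≥ 3`, `nh ≤ L`, with `x ↦ x mod L` injective on
`{-1, …, 2n+3}` (e.g. `L ≥ 2n + 5`). [cite: FawziFawziScalet2024Entropy, Theorem 4.1] [cite: KullEtAl2024, §II.B, §VI.B]
[cite: Han2020Bootstrap, §2] -/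
theorem ent_primal_chainWindow_energyPerSite_ge (t U : ℝ) (n : ℕ) (hL : 3 ≤ L) {nh : ℕ} (hn : nh ≤ L)
    (hInj : Set.InjOn (Torus.proj (d := 1) L) ↑(chainWindow (-1) (2 * (n : ℤ) + 3)))
    {ν E : ℝ} (hν : ν = (nh : ℝ) / (L : ℝ))
    (hclaim : ∀ ρ : Op (PolySite (chainWindow (-1) ((n : ℤ) + 1))) 4, ρ.PosSemidef → ρ.trace = 1 →
      spinPartialTrace ((PolySite.affEmb 1 (unitVec 0) (chainWindow (-1) (n : ℤ))).trans
          (PolySite.incl (affShiftSet_chainWindow_subset (-1) (n : ℤ)))) ρ =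
        spinPartialTrace (PolySite.incl (chainWindow_mono_right (-1) (by omega : (n : ℤ) ≤ n + 1))) ρ →
      (∀ σ : Fin 2, ∀ k k' : TensorIndex (PolySite (chainWindow (-1) ((n : ℤ) + 1))) 4,
        (∑ x, if σ ∈ siteOcc (k x) then 1 else 0 : ℕ) ≠ (∑ x, if σ ∈ siteOcc (k' x) then 1 else 0 : ℕ) → ρ k k' = 0) →
      (∀ σ : Fin 2, ((toSpin (nAt 0 (zero_mem_chainWindow (by omega : (0 : ℤ) ≤ n + 1)) σ) * ρ).trace).re = ν) →
      (∀ k k' : TensorIndex (PolySite (chainWindow (-1) ((n : ℤ) + 1))) 4, starRingEnd ℂ (ρ k k') = ρ k k') →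
      (∀ k k' : TensorIndex (PolySite (chainWindow (-1) ((n : ℤ) + 1))) 4, ‖ρ k k'‖ ≤ 1) →
      0 ≤ vonNeumannEntropy ρ -
        vonNeumannEntropy (spinPartialTrace (PolySite.incl (chainWindow_mono_right (-1) (by omega : (n : ℤ) ≤ n + 1))) ρ) →
      E ≤ ((toSpin (fermionEmbed (PolySite.incl (thicken_zero_one_subset_chainWindow (by omega : (1 : ℤ) ≤ n + 1)))
        ((hubbardFermionInteraction 1 t U).meanEnergyObs 1)) * ρ).trace).re) :
    E ≤ energyPerSite (hubbardChain L) t U (2 * nh) := by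
  obtain ⟨ρ, hρpsd, hρtr, hρLTI, hρsec, hρdens, hρreal, hρbd, hρent, hobj⟩ :=
    exists_lti_ent_feasible_chainWindow t U n hL hn hInj
  exact hobj ▸ hclaim ρ hρpsd hρtr hρLTI hρsec (fun σ => (hρdens σ).trans hν.symm) hρreal hρbd hρent

end Ring

/-! ### Thermodynamic limit: half filling and filling `p/q` -/

section Limit

/-- **THEOREM ENT-B0, fermion case (thermodynamic limit, half filling), canonical window.** With the window
`W' = {-1, 0, …, n+1}` and density target `1/2`: if `E ≤ Re tr(h ρ)` for every window variable satisfying the rows of THEOREM B0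
and the entropy row `0 ≤ S(ρ) − S(tr_{n+1} ρ)`, then `E ≤ hubbardChainEnergyDensity t U` (`U ≥ 0`; rings `L` even, `N = L`,
`L` large). [cite: FawziFawziScalet2024Entropy, Theorem 4.1] [cite: KullEtAl2024, §II.B, §VI.B] [cite: Ruelle1969, §2.2] -/
theorem ent_primal_chainWindow_energyDensity_ge (t : ℝ) {U : ℝ} (hU : 0 ≤ U) (n : ℕ) {E : ℝ}
    (hclaim : ∀ ρ : Op (PolySite (chainWindow (-1) ((n : ℤ) + 1))) 4, ρ.PosSemidef → ρ.trace = 1 →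
      spinPartialTrace ((PolySite.affEmb 1 (unitVec 0) (chainWindow (-1) (n : ℤ))).trans
          (PolySite.incl (affShiftSet_chainWindow_subset (-1) (n : ℤ)))) ρ =
        spinPartialTrace (PolySite.incl (chainWindow_mono_right (-1) (by omega : (n : ℤ) ≤ n + 1))) ρ →
      (∀ σ : Fin 2, ∀ k k' : TensorIndex (PolySite (chainWindow (-1) ((n : ℤ) + 1))) 4,
        (∑ x, if σ ∈ siteOcc (k x) then 1 else 0 : ℕ) ≠ (∑ x, if σ ∈ siteOcc (k' x) then 1 else 0 : ℕ) → ρ k k' = 0) →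
      (∀ σ : Fin 2, ((toSpin (nAt 0 (zero_mem_chainWindow (by omega : (0 : ℤ) ≤ n + 1)) σ) * ρ).trace).re = 1 / 2) →
      (∀ k k' : TensorIndex (PolySite (chainWindow (-1) ((n : ℤ) + 1))) 4, starRingEnd ℂ (ρ k k') = ρ k k') →
      (∀ k k' : TensorIndex (PolySite (chainWindow (-1) ((n : ℤ) + 1))) 4, ‖ρ k k'‖ ≤ 1) →
      0 ≤ vonNeumannEntropy ρ -
        vonNeumannEntropy (spinPartialTrace (PolySite.incl (chainWindow_mono_right (-1) (by omega : (n : ℤ) ≤ n + 1))) ρ) →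
      E ≤ ((toSpin (fermionEmbed (PolySite.incl (thicken_zero_one_subset_chainWindow (by omega : (1 : ℤ) ≤ n + 1)))
        ((hubbardFermionInteraction 1 t U).meanEnergyObs 1)) * ρ).trace).re) :
    E ≤ hubbardChainEnergyDensity t U := by
  obtain ⟨L₀, hL₀⟩ := exists_forall_le_injOn_proj (chainWindow (-1) (2 * (n : ℤ) + 3))
  refine hubbardChainEnergyDensity_ge_of_forall_ge t hU (max L₀ 3) fun L hL hLe => ?_
  have hL3 : 3 ≤ L := le_trans (le_max_right _ _) hL
  have hLL : L₀ ≤ L := le_trans (le_max_left _ _) hL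
  haveI : NeZero L := ⟨by omega⟩
  obtain ⟨m, hm⟩ := hLe
  have hmL : m ≤ L := by omega
  have hL0 : (L : ℝ) ≠ 0 := Nat.cast_ne_zero.2 (by omega)
  have hν : (1 / 2 : ℝ) = (m : ℝ) / (L : ℝ) := by
    rw [eq_div_iff hL0, hm]
    push_cast
    ring
  have key := ent_primal_chainWindow_energyPerSite_ge (L := L) t U n hL3 hmL (hL₀ L hLL) hν hclaim
  rw [energyPerSite_fermionTorusGraph_one] at key
  have h2 : 2 * m = L := by omega
  rw [h2] at key
  exact key

/-- **THEOREM ENT-B0, fermion case (thermodynamic limit, filling `p/q`), canonical window.** As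
`ent_primal_chainWindow_energyDensity_ge`, with density target `p/(2q)` per spin (`1 ≤ q`, `p ≤ 2q`, `U ≥ 0`):
`E ≤ hubbardChainEnergyDensityAt t U p q` (the rings `L = q·2k`, `N = p·2k`).
[cite: FawziFawziScalet2024Entropy, Theorem 4.1] [cite: KullEtAl2024, §II.B, §VI.B] [cite: Ruelle1969, §2.2] -/
theorem ent_primal_chainWindow_energyDensityAt_ge (t : ℝ) {U : ℝ} (hU : 0 ≤ U) {p q : ℕ} (hq : 1 ≤ q) (hp : p ≤ 2 * q)
    (n : ℕ) {E : ℝ}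
    (hclaim : ∀ ρ : Op (PolySite (chainWindow (-1) ((n : ℤ) + 1))) 4, ρ.PosSemidef → ρ.trace = 1 →
      spinPartialTrace ((PolySite.affEmb 1 (unitVec 0) (chainWindow (-1) (n : ℤ))).trans
          (PolySite.incl (affShiftSet_chainWindow_subset (-1) (n : ℤ)))) ρ =
        spinPartialTrace (PolySite.incl (chainWindow_mono_right (-1) (by omega : (n : ℤ) ≤ n + 1))) ρ →
      (∀ σ : Fin 2, ∀ k k' : TensorIndex (PolySite (chainWindow (-1) ((n : ℤ) + 1))) 4,
        (∑ x, if σ ∈ siteOcc (k x) then 1 else 0 : ℕ) ≠ (∑ x, if σ ∈ siteOcc (k' x) then 1 else 0 : ℕ) → ρ k k' = 0) →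
      (∀ σ : Fin 2, ((toSpin (nAt 0 (zero_mem_chainWindow (by omega : (0 : ℤ) ≤ n + 1)) σ) * ρ).trace).re =
        (p : ℝ) / (2 * (q : ℝ))) →
      (∀ k k' : TensorIndex (PolySite (chainWindow (-1) ((n : ℤ) + 1))) 4, starRingEnd ℂ (ρ k k') = ρ k k') →
      (∀ k k' : TensorIndex (PolySite (chainWindow (-1) ((n : ℤ) + 1))) 4, ‖ρ k k'‖ ≤ 1) →
      0 ≤ vonNeumannEntropy ρ -
        vonNeumannEntropy (spinPartialTrace (PolySite.incl (chainWindow_mono_right (-1) (by omega : (n : ℤ) ≤ n + 1))) ρ) →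
      E ≤ ((toSpin (fermionEmbed (PolySite.incl (thicken_zero_one_subset_chainWindow (by omega : (1 : ℤ) ≤ n + 1)))
        ((hubbardFermionInteraction 1 t U).meanEnergyObs 1)) * ρ).trace).re) :
    E ≤ hubbardChainEnergyDensityAt t U p q := by
  obtain ⟨L₀, hL₀⟩ := exists_forall_le_injOn_proj (chainWindow (-1) (2 * (n : ℤ) + 3))
  refine hubbardChainEnergyDensityAt_ge_of_frequently_ge t hU hq hp (Filter.frequently_atTop.2 fun m => ?_)
  -- the ring `L = q · (2k)` with `nh = p · k`, `k ≥ max m L₀ 3`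
  set k : ℕ := max m (max L₀ 3) with hk
  have hkm : m ≤ k := le_max_left _ _
  have hkL : L₀ ≤ k := le_trans (le_max_left _ _) (le_max_right _ _)
  have hk3 : 3 ≤ k := le_trans (le_max_right _ _) (le_max_right _ _)
  refine ⟨2 * k, by omega, ?_⟩
  have hL3 : 3 ≤ q * (2 * k) := le_trans hk3 (by nlinarith)
  have hLL : L₀ ≤ q * (2 * k) := le_trans hkL (by nlinarith)
  haveI : NeZero (q * (2 * k)) := ⟨by omega⟩
  have hn : p * k ≤ q * (2 * k) := by nlinarith
  have h2q : 2 * (q : ℝ) ≠ 0 := mul_ne_zero two_ne_zero (Nat.cast_ne_zero.2 (by omega))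
  have hqk : ((q * (2 * k) : ℕ) : ℝ) ≠ 0 := Nat.cast_ne_zero.2 (by omega)
  have hν : (p : ℝ) / (2 * (q : ℝ)) = ((p * k : ℕ) : ℝ) / ((q * (2 * k) : ℕ) : ℝ) := by
    rw [div_eq_div_iff h2q hqk]
    push_cast
    ring
  have key := ent_primal_chainWindow_energyPerSite_ge (L := q * (2 * k)) t U n hL3 hn (hL₀ _ hLL) hν hclaim
  rw [energyPerSite_fermionTorusGraph_one] at key
  have hN : 2 * (p * k) = p * (2 * k) := by ring
  rw [hN] at key
  exact key

end Limit

/-! ### Translates of even two-site observables have equal expectations under the LTI row -/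

section Translate

variable {Λ₀ Λ' : Finset (Site 1)}

/-- `y ↦ y + v` followed by an inclusion is strictly monotone (every `v`). [folklore] -/
theorem strictMono_affEmb_trans_incl' (v : Site 1) (hsh : affShiftSet 1 v Λ₀ ⊆ Λ') :
    StrictMono ((PolySite.affEmb 1 v Λ₀).trans (PolySite.incl hsh)) := by
  intro y y' hyy
  rw [PolySite.lt_iff_apply] at hyy ⊢
  simp only [Function.Embedding.trans_apply, PolySite.coe_incl, PolySite.ofLex_coe_affEmb, affSite_apply, Units.val_one,
    one_mul]
  linarith

/-- The translate of a chain window `{a, …, b}` by `v` inside `Λ'` consists of the sites with coordinate in `[a + v₀, b + v₀]`.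
[folklore] -/
theorem mem_range_affEmb_chainWindow_iff {a b : ℤ} (v : Site 1) (hsh : affShiftSet 1 v (chainWindow a b) ⊆ Λ')
    (r : PolySite Λ') :
    r ∈ Set.range ((PolySite.affEmb 1 v (chainWindow a b)).trans (PolySite.incl hsh)) ↔
      a + v 0 ≤ ofLex r.1 0 ∧ ofLex r.1 0 ≤ b + v 0 := by
  constructor
  · rintro ⟨y, rfl⟩
    have hy := mem_chainWindow.1 (PolySite.ofLex_mem y)
    simp only [Function.Embedding.trans_apply, PolySite.coe_incl, PolySite.ofLex_coe_affEmb, affSite_apply, Units.val_one,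
      one_mul]
    omega
  · intro hr
    have hy : (fun _ : Fin 1 => ofLex r.1 0 - v 0) ∈ chainWindow a b := by
      rw [mem_chainWindow]
      omega
    have hmem : affSite 1 v (fun _ : Fin 1 => ofLex r.1 0 - v 0) ∈ Λ' := by
      have e : affSite 1 v (fun _ : Fin 1 => ofLex r.1 0 - v 0) = ofLex r.1 := by
        funext i
        rw [Subsingleton.elim i 0, affSite_apply, Units.val_one, one_mul]
        ring
      rw [e]
      exact PolySite.ofLex_mem r
    refine ⟨PolySite.pt _ hy, polySite_eq_of_coord_eq ?_⟩
    simp only [Function.Embedding.trans_apply, PolySite.coe_incl, PolySite.ofLex_coe_affEmb, affSite_apply, Units.val_one,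
      one_mul, PolySite.ofLex_coe_pt]
    ring

/-- The translate of a chain window is an order interval of `Λ'`. [folklore] -/
theorem ordConnected_range_affEmb_chainWindow {a b : ℤ} (v : Site 1) (hsh : affShiftSet 1 v (chainWindow a b) ⊆ Λ') :
    (Set.range ((PolySite.affEmb 1 v (chainWindow a b)).trans (PolySite.incl hsh))).OrdConnected := by
  refine Set.ordConnected_iff.2 fun p hp q hq _ r hr => ?_
  rw [mem_range_affEmb_chainWindow_iff] at hp hq ⊢
  have h1 := (PolySite.le_iff_apply p r).1 hr.1
  have h2 := (PolySite.le_iff_apply r q).1 hr.2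
  constructor <;> omega

/-- **Translates of an even observable of the two-site sub-window `{-1, 0}` have the same expectation in an LTI window state** of
the canonical window `{-1, …, n+1}`: for `a ∈ 𝔄_{\{-1,0\}}` even and the translation by `c ≤ n + 1`,
`tr(toSpin(Γ_{\{-1,0\}+c ↪ Λ'}(τ_c a)) ρ) = tr(toSpin(Γ_{\{-1,0\} ↪ Λ'} a) ρ)` — shift consistency (`spinPartialTrace_eq_of_shift`) and
the string-free Jordan–Wigner reading of even elements (`toSpin_fermionEmbed_of_even`). [cite: KullEtAl2024, §II.B eq. (locTIn)]
[cite: ArakiMoriya2003, §4.1] -/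
theorem trace_toSpin_translate_eq_of_lti (n : ℕ) (v : Site 1)
    (hsh : affShiftSet 1 v (chainWindow (-1) 0) ⊆ chainWindow (-1) ((n : ℤ) + 1))
    (hB : chainWindow (-1) 0 ⊆ chainWindow (-1) ((n : ℤ) + 1)) {c : ℕ} (hv : v 0 = (c : ℤ))
    {ρ : Op (PolySite (chainWindow (-1) ((n : ℤ) + 1))) 4}
    (hLTI : spinPartialTrace ((PolySite.affEmb 1 (unitVec 0) (chainWindow (-1) (n : ℤ))).trans
        (PolySite.incl (affShiftSet_chainWindow_subset (-1) (n : ℤ)))) ρ =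
      spinPartialTrace (PolySite.incl (chainWindow_mono_right (-1) (by omega : (n : ℤ) ≤ n + 1))) ρ)
    {a : FermionOp (chainWindow (-1) 0)} (ha : parityAut a = a) :
    (toSpin (fermionEmbed ((PolySite.affEmb 1 v (chainWindow (-1) 0)).trans (PolySite.incl hsh)) a) * ρ).trace =
      (toSpin (fermionEmbed (PolySite.incl hB) a) * ρ).trace := by
  have hφ₁ : ∀ y, ofLex (((PolySite.affEmb 1 (unitVec 0) (chainWindow (-1) (n : ℤ))).trans
      (PolySite.incl (affShiftSet_chainWindow_subset (-1) (n : ℤ)))) y).1 0 = ofLex y.1 0 + 1 := fun y => by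
    rw [shift_affEmb_trans_incl, chain_unitVec_apply_zero]
  have hψ : ∀ y, ofLex (((PolySite.affEmb 1 v (chainWindow (-1) 0)).trans (PolySite.incl hsh)) y).1 0 =
      ofLex y.1 0 + (c : ℤ) := fun y => by
    rw [shift_affEmb_trans_incl, hv]
  rw [toSpin_fermionEmbed_of_even _ (strictMono_affEmb_trans_incl' v hsh) (ordConnected_range_affEmb_chainWindow v hsh) ha,
    toSpin_fermionEmbed_of_strictMono_of_isLowerSet _ (strictMono_incl hB) (isLowerSet_range_incl_chainWindow hB),
    ← trace_mul_spinPartialTrace, ← trace_mul_spinPartialTrace,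
    spinPartialTrace_eq_of_shift (shift_incl (chainWindow_mono_right (-1) (by omega : (n : ℤ) ≤ n + 1))) hφ₁ hLTI c hψ
      (shift_incl hB)]

end Translate

end Summit.Ventures.CertifiedManyBodySolver.Transport
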